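import Literature.MathematicalPhysics.QuantumFieldTheory.Balaban1983to89.B6DeltaJKernelTwoScaleV1
import Literature.MathematicalPhysics.QuantumFieldTheory.Balaban1983to89.B6QppKernelV1
import Literature.MathematicalPhysics.QuantumFieldTheory.Balaban1983to89.B6Cov2110WeightV1

/-!
# `Balaban1983to89.B6CovTildeRowSumV1` — T. Bałaban, *Propagators and renormalization transformations for lattice gauge
# theories. II*, Commun. Math. Phys. **96** (1984) 223–250 [Balaban1984PropagatorsII], p. 246 (text after (2.128)): *«… a covariance C̃^{(j)}_Λ of the
# Gaussian integral in (2.119) … has an exponential decay with a decay rate having the same property»* — THE ROW SUMS OF THE SCHUR MAJORANT OF THE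
# KERNEL OF `Q″*aQ″ + Δ_j` FOR THE CONCRETE TWO-SCALE DATA `tsV1`: the finite-range part contributes `(e^{3Lδ} − 1)·2w₁`, the `Δ_j` part
# `δ·κ·C_Δ·(4/κ₁)(d+1)·latticeConst` — uniformly in the volume and in `Λ′`

statement-level skeleton of published theorems with citation tags; proofs where landed; nothing here is a claim about the Yang–Mills mass gap

PDF held: `paper:balaban1984-cmp96-propagators-rt-ii` (journal page = PDF page + 222; p. 246 [PDF 24] read AS IMAGE on the ×2 render
`run/shared/lean/pub/pub-balaban/b2b-balaban-ref1/pages/1984-cmp96-propagators-rt-II/…-p024-x2.png`, 2026-08-22).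

PRINT (verbatim, p. 246).  *"These forms are bounded from below by γ₀″‖B‖² with a positive constant γ₀″ dependent on d and L only. This implies that a
covariance C̃^{(j)}_Λ of the Gaussian integral in (2.119) is bounded from above by a positive constant dependent on d and L only, and it has an
exponential decay with a decay rate having the same property."*

CITATION HEADER (lean-in-tree rule) — WHAT IS REPRODUCED.  Phase-2 file of the `lit-balaban` typed skeleton (HOME
`run/shared/lean/pub/lit-balaban/`), seat **p22 gen 12** (B6 fold owner r03, referee ref-4; lane = the Sect. C chain (2.95)–(2.147) on the
concrete two-scale data `tsV1`).  SKELETON row **B6.Txt@246** (the «exponential decay» clause of the C̃-sentence) — the analytic half of the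
conjugation-error (Schur) hypothesis `hSe` of `…B6CovTildeMatrixV1.covt_kernel_decay_of_herr`; the successor file assembles `hSe` and the decay.
IMPORTS BY NAME: `…B6DeltaJKernelTwoScaleV1.kernel_Δj_decay` (kernel of the concrete `Δ_j`), `…B6QppKernelV1.qpp_single_nonneg/qpp_single_inl_ne_zero/
qpp_single_inr_ne_zero/sum_qpp_single_col/sum_qpp_single_row_le` (kernel of `Q″*aQ″`: sign, block locality, masses), gen 11's
`…B6Cov2110WeightV1.torusSupNorm_anchor_le/torusSupNorm_sub_le/torusSupNorm_neg/torusSupNorm_zero`, p21/r02's uniform torus sum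
`…B5Hk163TorusHolderRate.sum_exp_torusSupNorm_sub_rep_le`, `B4TorusKernel.MultiPeriod.circAbs_add_mul/circAbs_le_abs`, `B4Sect5Torus.circAbs_zero`,
`TorusGeometry.Site.val_blockSite`, `Params.sitesPerDir_eq_mul_succ`.  THIS FILE (parameter set written `⟨d + 1, L, m, K, _, _⟩` — every `P : Params`
has this form; `D(b, b′) = |x_b − x_{b′}|_T` the torus sup-distance of the box representatives of the source sites; `q_i(b) = (Q″e_b)_i`;
`κ = c²/(η^{d+1}L^{2j})`, `κ₁ = κ₁₆₆(d+1)/(d+1)`, `C_Δ = M_C(d+1, κ₁₆₆)·periodConst(κ₁₆₆, d)`):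
* §1 geometry of centred blocks on the torus: **`torusSupNorm_anchor_shift_le`** (the anchors of `B(y)` and `B(y + e_μ)` are within `L`),
  **`dist_le_of_blocks`** (two bonds starting in `B(y) ∪ B(y + e_μ)` have `D ≤ 3L − 2`), **`dist_le_of_qpp_ne_zero`** (`q_i(b)q_i(b′) ≠ 0 ⇒ D(b, b′) ≤ 3L − 2`);
* §2 **`rowSum_Q_le`**: `Σ_{b′}(e^{δD(b,b′)} − 1)·Σ_i w_i q_i(b)q_i(b′) ≤ (e^{3Lδ} − 1)·2w₁` for `0 ≤ δ` and weights `0 < w ≤ w₁`;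
* §3 **`rowSum_Δ_le`**: `Σ_{b′}(e^{δD(b,b′)} − 1)·|⟨e_b, Δ_je_{b′}⟩| ≤ δ·κ·C_Δ·(4/κ₁)·(d+1)·latticeConst(d+1, κ₁/4)` for `0 ≤ δ ≤ κ₁/2`.
THEOREMS ONLY (no definition, no `def … : Prop` fact); standard axioms.  HONEST SCOPE: crude explicit constants (ours); finite tori of the V1 calculus,
centred blocks (`L` odd), standing range `j + 1 ≤ m + K`; NOT summit progress.
-/

noncomputable section

open scoped InnerProductSpace
open Finset

namespace Literature.MathematicalPhysics.QuantumFieldTheory.Balaban1983to89.B6CovTildeRowSumV1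

open LatticeFieldCalculus B6SectAOperatorsV1 B6SectCTwoScaleV1 B6SectCTwoScaleV1Lattice
open B6SectCOperators (TwoScaleData)
open B5SectBStatements (eta)
open B4TorusKernel (periodConst)
open B4TorusKernel.MultiPeriod (circAbs circAbs_le_abs circAbs_add_mul torusSupNorm torusSupNorm_nonneg)
open B4Sect5Torus (circAbs_zero)
open B4Sect5Proof (latticeConst latticeConst_nonneg)
open B5Eq117TorusCarriers (Mk)
open B5Hk163TorusHolderRate (sum_exp_torusSupNorm_sub_rep_le)
open B6LowerBound2153Torus (rep)
open B6Cov2156Torus (one_le_M)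
open B12Eq443LatticeMoments (MC)
open B5Symbol166Strip (kappa166 kappa166_pos)
open B6DeltaJKernelTwoScaleV1 (kernel_Δj_decay)
open B6QppKernelV1 (qpp_single_nonneg qpp_single_inl_ne_zero qpp_single_inr_ne_zero sum_qpp_single_col sum_qpp_single_row_le)
open B6Cov2110WeightV1 (torusSupNorm_anchor_le torusSupNorm_sub_le torusSupNorm_neg torusSupNorm_zero)

/-! ## §1  Geometry of the centred blocks on the unit torus `T^{(j)}` -/

section Geometry

variable {d L m K : ℕ} {hd : 1 ≤ d + 1} {hL : Odd L ∧ 1 < L} {j : ℕ}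

/-- **THE ANCHORS OF ADJACENT BLOCKS ARE WITHIN `L`**: `|x̂(y + e_μ) − x̂(y)|_T ≤ L` for the anchors `x̂(y) = blockSite y 0` (labels differ by `L` in the
coordinate `μ`, or by `−(N − 1)L ≡ L` modulo the period `N·L` at the wrap-around). [cite: Balaban1984PropagatorsI, (1.6) p.18] -/
theorem torusSupNorm_anchor_shift_le (hj : j + 1 ≤ m + K) (y : Site (⟨d + 1, L, m, K, hd, hL⟩ : Params) (j + 1)) (μ : Fin (d + 1)) :
    torusSupNorm (Mk ⟨d + 1, L, m, K, hd, hL⟩ j)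
        (rep (Mk ⟨d + 1, L, m, K, hd, hL⟩ j) (Site.blockSite (y.shift μ) (fun _ => ⟨0, Params.L_pos _⟩)) -
          rep (Mk ⟨d + 1, L, m, K, hd, hL⟩ j) (Site.blockSite y (fun _ => ⟨0, Params.L_pos _⟩))) ≤ L := by
  have hjP : j + 1 ≤ (⟨d + 1, L, m, K, hd, hL⟩ : Params).m + (⟨d + 1, L, m, K, hd, hL⟩ : Params).K := hj
  unfold torusSupNorm
  refine Finset.sup'_le _ _ fun i _ => ?_
  have hval : ∀ z : Site (⟨d + 1, L, m, K, hd, hL⟩ : Params) (j + 1),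
      rep (Mk ⟨d + 1, L, m, K, hd, hL⟩ j) (Site.blockSite z (fun _ => ⟨0, Params.L_pos _⟩)) i = ((z i).val : ℤ) * L := by
    intro z
    simp only [rep]
    rw [Site.val_blockSite (P := ⟨d + 1, L, m, K, hd, hL⟩) hjP]
    simp only [add_zero, Nat.cast_mul]
  rw [Pi.sub_apply, hval, hval]
  by_cases hi : i = μ
  · subst hi
    have hshift : (y.shift i) i = y i + 1 := by simp [Site.shift]
    rw [hshift, ZMod.val_add, ZMod.val_one]
    set v := (y i).val with hv
    have hvlt : v < (⟨d + 1, L, m, K, hd, hL⟩ : Params).sitesPerDir (j + 1) := ZMod.val_lt _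
    by_cases hwrap : v + 1 < (⟨d + 1, L, m, K, hd, hL⟩ : Params).sitesPerDir (j + 1)
    · rw [Nat.mod_eq_of_lt hwrap]
      have h1 : (((v + 1 : ℕ) : ℤ) * L - (v : ℤ) * L) = (L : ℤ) := by push_cast; ring
      rw [h1]
      have h2 := circAbs_le_abs (one_le_M (Mk ⟨d + 1, L, m, K, hd, hL⟩ j) i) (L : ℤ)
      rw [abs_of_nonneg (by positivity)] at h2
      exact_mod_cast h2
    · have heq : v + 1 = (⟨d + 1, L, m, K, hd, hL⟩ : Params).sitesPerDir (j + 1) := by omega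
      rw [heq, Nat.mod_self]
      have hM : Mk ⟨d + 1, L, m, K, hd, hL⟩ j i = (⟨d + 1, L, m, K, hd, hL⟩ : Params).sitesPerDir (j + 1) * L :=
        (⟨d + 1, L, m, K, hd, hL⟩ : Params).sitesPerDir_eq_mul_succ hjP
      have h1 : (((0 : ℕ) : ℤ) * L - (v : ℤ) * L) =
          (L : ℤ) + (((⟨d + 1, L, m, K, hd, hL⟩ : Params).sitesPerDir (j + 1) * L : ℕ) : ℤ) * (-1) := by
        have : (v : ℤ) = ((⟨d + 1, L, m, K, hd, hL⟩ : Params).sitesPerDir (j + 1) : ℤ) - 1 := by rw [← heq]; push_cast; ring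
        rw [this]
        push_cast
        ring
      rw [h1, ← hM, circAbs_add_mul]
      have h2 := circAbs_le_abs (one_le_M (Mk ⟨d + 1, L, m, K, hd, hL⟩ j) i) (L : ℤ)
      rw [abs_of_nonneg (by positivity)] at h2
      exact_mod_cast h2
  · have hshift : (y.shift μ) i = y i := by simp [Site.shift, Function.update_of_ne hi]
    rw [hshift, sub_self, circAbs_zero]
    exact_mod_cast (Nat.zero_le L)

/-- **TWO BONDS STARTING IN `B(y) ∪ B(y + e_μ)` ARE WITHIN `3L − 2`** (torus sup-distance of the box representatives of the source sites): each source
is within `L − 1` of the anchor of its block (`torusSupNorm_anchor_le`) and the two anchors are within `L`. [cite: Balaban1984PropagatorsI, (1.11) p.19] -/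
theorem dist_le_of_blocks (hj : j + 1 ≤ m + K) (y : Site (⟨d + 1, L, m, K, hd, hL⟩ : Params) (j + 1)) (μ : Fin (d + 1))
    (b b' : PBond (⟨d + 1, L, m, K, hd, hL⟩ : Params) j) (hb : blockOf b.src = y ∨ blockOf b.src = y.shift μ)
    (hb' : blockOf b'.src = y ∨ blockOf b'.src = y.shift μ) :
    torusSupNorm (Mk ⟨d + 1, L, m, K, hd, hL⟩ j) (rep (Mk ⟨d + 1, L, m, K, hd, hL⟩ j) b.src - rep (Mk ⟨d + 1, L, m, K, hd, hL⟩ j) b'.src) ≤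
      3 * (L : ℝ) - 2 := by
  set M := Mk (⟨d + 1, L, m, K, hd, hL⟩ : Params) j with hM
  set a := rep M (Site.blockSite (blockOf b.src) (fun _ => ⟨0, Params.L_pos _⟩)) with ha
  set a' := rep M (Site.blockSite (blockOf b'.src) (fun _ => ⟨0, Params.L_pos _⟩)) with ha'
  have h1 : torusSupNorm M (rep M b.src - a) ≤ (L : ℝ) - 1 := torusSupNorm_anchor_le hj b.src
  have h2 : torusSupNorm M (a' - rep M b'.src) ≤ (L : ℝ) - 1 := by
    rw [← torusSupNorm_neg M, neg_sub]
    exact torusSupNorm_anchor_le hj b'.src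
  -- the two anchors are within `L`
  have hA : ∀ z z' : Site (⟨d + 1, L, m, K, hd, hL⟩ : Params) (j + 1), (z = y ∨ z = y.shift μ) → (z' = y ∨ z' = y.shift μ) →
      torusSupNorm M (rep M (Site.blockSite z (fun _ => ⟨0, Params.L_pos _⟩)) - rep M (Site.blockSite z' (fun _ => ⟨0, Params.L_pos _⟩))) ≤ L := by
    have hL0 : (0 : ℝ) ≤ L := Nat.cast_nonneg L
    intro z z' hz hz'
    rcases hz with rfl | rfl <;> rcases hz' with rfl | rfl
    · rw [sub_self, torusSupNorm_zero]; exact hL0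
    · rw [← torusSupNorm_neg M, neg_sub]; exact torusSupNorm_anchor_shift_le hj _ μ
    · exact torusSupNorm_anchor_shift_le hj _ μ
    · rw [sub_self, torusSupNorm_zero]; exact hL0
  have h3 : torusSupNorm M (a - a') ≤ L := hA _ _ hb hb'
  calc torusSupNorm M (rep M b.src - rep M b'.src)
      ≤ torusSupNorm M (rep M b.src - a) + torusSupNorm M (a - rep M b'.src) := torusSupNorm_sub_le M _ _ _
    _ ≤ torusSupNorm M (rep M b.src - a) + (torusSupNorm M (a - a') + torusSupNorm M (a' - rep M b'.src)) := by
        linarith [torusSupNorm_sub_le M a a' (rep M b'.src)]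
    _ ≤ ((L : ℝ) - 1) + (L + ((L : ℝ) - 1)) := by linarith
    _ = 3 * (L : ℝ) - 2 := by ring

variable (Λ' : Finset (Site (⟨d + 1, L, m, K, hd, hL⟩ : Params) (j + 1))) [DecidableEq (PBond (⟨d + 1, L, m, K, hd, hL⟩ : Params) j)]

/-- **THE KERNEL OF `Q″*aQ″` HAS RANGE `3L − 2`**: `q_i(b) ≠ 0` and `q_i(b′) ≠ 0` force `D(b, b′) ≤ 3L − 2` (`i` a `Λ^c`-bond: `b = b′`; `i` a `Λ′`-bond `c`:
both sources lie in `B(c₋) ∪ B(c₊)`). [cite: Balaban1984PropagatorsII, (2.119) p.243] -/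
theorem dist_le_of_qpp_ne_zero (hj : j + 1 ≤ m + K) (i : CIdx j Λ') (b b' : PBond (⟨d + 1, L, m, K, hd, hL⟩ : Params) j)
    (hb : Qpp ⟨d + 1, L, m, K, hd, hL⟩ j Λ' (EuclideanSpace.single b (1 : ℝ)) i ≠ 0)
    (hb' : Qpp ⟨d + 1, L, m, K, hd, hL⟩ j Λ' (EuclideanSpace.single b' (1 : ℝ)) i ≠ 0) :
    torusSupNorm (Mk ⟨d + 1, L, m, K, hd, hL⟩ j) (rep (Mk ⟨d + 1, L, m, K, hd, hL⟩ j) b.src - rep (Mk ⟨d + 1, L, m, K, hd, hL⟩ j) b'.src) ≤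
      3 * (L : ℝ) - 2 := by
  have hL1 : (1 : ℝ) ≤ L := by exact_mod_cast hL.2.le
  rcases i with o | e
  · rw [qpp_single_inl_ne_zero Λ' hb, qpp_single_inl_ne_zero Λ' hb', sub_self, torusSupNorm_zero]
    linarith
  · exact dist_le_of_blocks hj e.1.src e.1.dir b b' (qpp_single_inr_ne_zero Λ' hj hb) (qpp_single_inr_ne_zero Λ' hj hb')

end Geometry

/-! ## §2  The row sums of the `Q″*aQ″` part -/

section RowSums

variable {d L m K : ℕ} {hd : 1 ≤ d + 1} {hL : Odd L ∧ 1 < L} {c : ℝ} (hc : c ≠ 0) {j : ℕ}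
  (Λ' : Finset (Site (⟨d + 1, L, m, K, hd, hL⟩ : Params) (j + 1))) {w : CIdx j Λ' → ℝ} (hw : ∀ i, 0 < w i)
  [DecidableEq (PBond (⟨d + 1, L, m, K, hd, hL⟩ : Params) j)]

include hw in
/-- **ROW SUMS OF THE FINITE-RANGE PART**: for `0 ≤ δ` and weights `w ≤ w₁`,
`Σ_{b′}(e^{δD(b,b′)} − 1)·Σ_i w_i q_i(b)q_i(b′) ≤ (e^{3Lδ} − 1)·2w₁` (range `3L − 2`, column mass `1`, row mass `≤ 2`).
[cite: Balaban1984PropagatorsII, (2.119) p.243 + p.246 (text after (2.128))] -/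
theorem rowSum_Q_le (hj : j + 1 ≤ m + K) {w₁ : ℝ} (hw₁ : 0 ≤ w₁) (hw1 : ∀ i, w i ≤ w₁) {δ : ℝ} (hδ0 : 0 ≤ δ) (b : PBond (⟨d + 1, L, m, K, hd, hL⟩ : Params) j) :
    ∑ b' : PBond (⟨d + 1, L, m, K, hd, hL⟩ : Params) j,
        (Real.exp (δ * torusSupNorm (Mk ⟨d + 1, L, m, K, hd, hL⟩ j)
            (rep (Mk ⟨d + 1, L, m, K, hd, hL⟩ j) b.src - rep (Mk ⟨d + 1, L, m, K, hd, hL⟩ j) b'.src)) - 1) *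
          ∑ i : CIdx j Λ', w i * (Qpp ⟨d + 1, L, m, K, hd, hL⟩ j Λ' (EuclideanSpace.single b (1 : ℝ)) i *
            Qpp ⟨d + 1, L, m, K, hd, hL⟩ j Λ' (EuclideanSpace.single b' (1 : ℝ)) i) ≤
      (Real.exp (3 * L * δ) - 1) * (2 * w₁) := by
  set M := Mk (⟨d + 1, L, m, K, hd, hL⟩ : Params) j with hM
  have hE : 0 ≤ Real.exp (3 * L * δ) - 1 := by
    have : 0 ≤ 3 * (L : ℝ) * δ := by positivity
    linarith [Real.add_one_le_exp (3 * (L : ℝ) * δ)]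
  -- pointwise: on the support the distance is at most `3L − 2 ≤ 3L`
  have hpt : ∀ (b' : PBond (⟨d + 1, L, m, K, hd, hL⟩ : Params) j) (i : CIdx j Λ'),
      (Real.exp (δ * torusSupNorm M (rep M b.src - rep M b'.src)) - 1) *
          (w i * (Qpp ⟨d + 1, L, m, K, hd, hL⟩ j Λ' (EuclideanSpace.single b (1 : ℝ)) i * Qpp ⟨d + 1, L, m, K, hd, hL⟩ j Λ' (EuclideanSpace.single b' (1 : ℝ)) i)) ≤
        (Real.exp (3 * L * δ) - 1) * (w i * (Qpp ⟨d + 1, L, m, K, hd, hL⟩ j Λ' (EuclideanSpace.single b (1 : ℝ)) i * Qpp ⟨d + 1, L, m, K, hd, hL⟩ j Λ' (EuclideanSpace.single b' (1 : ℝ)) i)) := by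
    intro b' i
    by_cases hq : Qpp ⟨d + 1, L, m, K, hd, hL⟩ j Λ' (EuclideanSpace.single b (1 : ℝ)) i * Qpp ⟨d + 1, L, m, K, hd, hL⟩ j Λ' (EuclideanSpace.single b' (1 : ℝ)) i = 0
    · rw [hq, mul_zero, mul_zero, mul_zero]
    · have hne := mul_ne_zero_iff.1 hq
      have hD := dist_le_of_qpp_ne_zero Λ' hj i b b' hne.1 hne.2
      refine mul_le_mul_of_nonneg_right (sub_le_sub_right (Real.exp_le_exp.2 ?_) 1)
        (mul_nonneg (hw i).le (mul_nonneg (qpp_single_nonneg Λ' b i) (qpp_single_nonneg Λ' b' i)))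
      have hD0 := torusSupNorm_nonneg (one_le_M M) (rep M b.src - rep M b'.src)
      nlinarith
  calc ∑ b' : PBond (⟨d + 1, L, m, K, hd, hL⟩ : Params) j, (Real.exp (δ * torusSupNorm M (rep M b.src - rep M b'.src)) - 1) *
          ∑ i : CIdx j Λ', w i * (Qpp ⟨d + 1, L, m, K, hd, hL⟩ j Λ' (EuclideanSpace.single b (1 : ℝ)) i * Qpp ⟨d + 1, L, m, K, hd, hL⟩ j Λ' (EuclideanSpace.single b' (1 : ℝ)) i)
      = ∑ b' : PBond (⟨d + 1, L, m, K, hd, hL⟩ : Params) j, ∑ i : CIdx j Λ', (Real.exp (δ * torusSupNorm M (rep M b.src - rep M b'.src)) - 1) *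
          (w i * (Qpp ⟨d + 1, L, m, K, hd, hL⟩ j Λ' (EuclideanSpace.single b (1 : ℝ)) i * Qpp ⟨d + 1, L, m, K, hd, hL⟩ j Λ' (EuclideanSpace.single b' (1 : ℝ)) i)) :=
        Finset.sum_congr rfl fun b' _ => Finset.mul_sum _ _ _
    _ ≤ ∑ b' : PBond (⟨d + 1, L, m, K, hd, hL⟩ : Params) j, ∑ i : CIdx j Λ', (Real.exp (3 * L * δ) - 1) *
          (w i * (Qpp ⟨d + 1, L, m, K, hd, hL⟩ j Λ' (EuclideanSpace.single b (1 : ℝ)) i * Qpp ⟨d + 1, L, m, K, hd, hL⟩ j Λ' (EuclideanSpace.single b' (1 : ℝ)) i)) :=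
        Finset.sum_le_sum fun b' _ => Finset.sum_le_sum fun i _ => hpt b' i
    _ = (Real.exp (3 * L * δ) - 1) * ∑ i : CIdx j Λ', w i * Qpp ⟨d + 1, L, m, K, hd, hL⟩ j Λ' (EuclideanSpace.single b (1 : ℝ)) i *
          ∑ b' : PBond (⟨d + 1, L, m, K, hd, hL⟩ : Params) j, Qpp ⟨d + 1, L, m, K, hd, hL⟩ j Λ' (EuclideanSpace.single b' (1 : ℝ)) i := by
        rw [Finset.sum_comm, Finset.mul_sum]
        refine Finset.sum_congr rfl fun i _ => ?_
        rw [Finset.mul_sum, Finset.mul_sum]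
        exact Finset.sum_congr rfl fun b' _ => by ring
    _ = (Real.exp (3 * L * δ) - 1) * ∑ i : CIdx j Λ', w i * Qpp ⟨d + 1, L, m, K, hd, hL⟩ j Λ' (EuclideanSpace.single b (1 : ℝ)) i := by
        congr 1
        exact Finset.sum_congr rfl fun i _ => by rw [sum_qpp_single_col, mul_one]
    _ ≤ (Real.exp (3 * L * δ) - 1) * (w₁ * ∑ i : CIdx j Λ', Qpp ⟨d + 1, L, m, K, hd, hL⟩ j Λ' (EuclideanSpace.single b (1 : ℝ)) i) := by
        refine mul_le_mul_of_nonneg_left ?_ hE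
        rw [Finset.mul_sum]
        exact Finset.sum_le_sum fun i _ => mul_le_mul_of_nonneg_right (hw1 i) (qpp_single_nonneg Λ' b i)
    _ ≤ (Real.exp (3 * L * δ) - 1) * (2 * w₁) := by
        refine mul_le_mul_of_nonneg_left ?_ hE
        have h := sum_qpp_single_row_le Λ' hj b
        nlinarith

/-! ## §3  The row sums of the `Δ_j` part -/

/-- the pointwise majorant: for `0 ≤ s ≤ Θe^{−κD}`, `0 ≤ δ ≤ κ/2`, `D ≥ 0`, `(e^{δD} − 1)s ≤ δ·Θ·(4/κ)·e^{−(κ/4)D}` (`e^t − 1 ≤ te^t`,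
`De^{−(κ/4)D} ≤ 4/κ`). [folklore] -/
private theorem pointwise_le₀ {κ δ D Θ s : ℝ} (hκ : 0 < κ) (hδ0 : 0 ≤ δ) (hδ : δ ≤ κ / 2) (hD : 0 ≤ D) (hs0 : 0 ≤ s)
    (hs : s ≤ Θ * Real.exp (-(κ * D))) : (Real.exp (δ * D) - 1) * s ≤ δ * (Θ * (4 / κ)) * Real.exp (-(κ / 4 * D)) := by
  have hΘ : 0 ≤ Θ := by
    by_contra h
    have : Θ * Real.exp (-(κ * D)) < 0 := mul_neg_of_neg_of_pos (not_le.1 h) (Real.exp_pos _)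
    linarith
  have ht0 : 0 ≤ δ * D := by positivity
  have h1 : Real.exp (δ * D) - 1 ≤ δ * D * Real.exp (δ * D) := by
    have h2 : 1 - δ * D ≤ Real.exp (-(δ * D)) := by linarith [Real.add_one_le_exp (-(δ * D))]
    have h3 : Real.exp (δ * D) * Real.exp (-(δ * D)) = 1 := by rw [← Real.exp_add, add_neg_cancel, Real.exp_zero]
    nlinarith [Real.exp_pos (δ * D), mul_le_mul_of_nonneg_left h2 (Real.exp_pos (δ * D)).le]
  have hA : Real.exp (δ * D) * Real.exp (-(κ * D)) ≤ Real.exp (-(κ / 4 * D)) * Real.exp (-(κ / 4 * D)) := by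
    rw [← Real.exp_add, ← Real.exp_add]
    refine Real.exp_le_exp.2 ?_
    nlinarith [mul_le_mul_of_nonneg_right hδ hD]
  have hB : D * Real.exp (-(κ / 4 * D)) ≤ 4 / κ := by
    have h3 : κ / 4 * D ≤ Real.exp (κ / 4 * D) := by linarith [Real.add_one_le_exp (κ / 4 * D)]
    have h4 : Real.exp (κ / 4 * D) * Real.exp (-(κ / 4 * D)) = 1 := by rw [← Real.exp_add, add_neg_cancel, Real.exp_zero]
    rw [le_div_iff₀ hκ]
    calc D * Real.exp (-(κ / 4 * D)) * κ = 4 * (κ / 4 * D * Real.exp (-(κ / 4 * D))) := by ring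
      _ ≤ 4 * (Real.exp (κ / 4 * D) * Real.exp (-(κ / 4 * D))) :=
          mul_le_mul_of_nonneg_left (mul_le_mul_of_nonneg_right h3 (Real.exp_pos _).le) (by norm_num)
      _ = 4 := by rw [h4, mul_one]
  calc (Real.exp (δ * D) - 1) * s ≤ δ * D * Real.exp (δ * D) * s := mul_le_mul_of_nonneg_right h1 hs0
    _ ≤ δ * D * Real.exp (δ * D) * (Θ * Real.exp (-(κ * D))) := mul_le_mul_of_nonneg_left hs (by positivity)
    _ = δ * Θ * D * (Real.exp (δ * D) * Real.exp (-(κ * D))) := by ring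
    _ ≤ δ * Θ * D * (Real.exp (-(κ / 4 * D)) * Real.exp (-(κ / 4 * D))) := mul_le_mul_of_nonneg_left hA (by positivity)
    _ = δ * Θ * (D * Real.exp (-(κ / 4 * D))) * Real.exp (-(κ / 4 * D)) := by ring
    _ ≤ δ * Θ * (4 / κ) * Real.exp (-(κ / 4 * D)) := mul_le_mul_of_nonneg_right (mul_le_mul_of_nonneg_left hB (by positivity)) (Real.exp_pos _).le
    _ = δ * (Θ * (4 / κ)) * Real.exp (-(κ / 4 * D)) := by ring

omit [DecidableEq (PBond (⟨d + 1, L, m, K, hd, hL⟩ : Params) j)] in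
/-- a sum over bonds is a double sum over sites and directions. [folklore] -/
private theorem sum_bond_eq {α : Type*} [AddCommMonoid α] (F : PBond (⟨d + 1, L, m, K, hd, hL⟩ : Params) j → α) :
    ∑ b, F b = ∑ x : Site (⟨d + 1, L, m, K, hd, hL⟩ : Params) j, ∑ μ : Fin (d + 1), F ⟨x, μ⟩ :=
  calc ∑ b, F b = ∑ p : Site (⟨d + 1, L, m, K, hd, hL⟩ : Params) j × Fin (d + 1), F (bondEquiv p) :=
      (Equiv.sum_comp (bondEquiv (P := ⟨d + 1, L, m, K, hd, hL⟩) (j := j)) F).symm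
    _ = _ := Fintype.sum_prod_type _

include hw in
/-- **ROW SUMS OF THE `Δ_j` PART**: for `0 ≤ δ ≤ κ₁/2`, `κ₁ = κ₁₆₆(d+1)/(d+1)`,
`Σ_{b′}(e^{δD(b,b′)} − 1)·|⟨e_b, Δ_je_{b′}⟩| ≤ δ·κ·C_Δ·(4/κ₁)·((d+1)·latticeConst(d+1, κ₁/4))`, `κ = c²/(η^{d+1}L^{2j})`,
`C_Δ = M_C(d+1, κ₁₆₆)·periodConst(κ₁₆₆, d)` (the kernel decay of the concrete `Δ_j` and the uniform torus sum BY NAME).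
[cite: Balaban1984PropagatorsII, p.246 (text after (2.128)) + p.250 (text before (2.157))] -/
theorem rowSum_Δ_le (hj : j + 1 ≤ m + K) {δ : ℝ} (hδ0 : 0 ≤ δ) (hδ : δ ≤ kappa166 (d + 1) / ((d : ℝ) + 1) / 2)
    (b : PBond (⟨d + 1, L, m, K, hd, hL⟩ : Params) j) :
    ∑ b' : PBond (⟨d + 1, L, m, K, hd, hL⟩ : Params) j,
        (Real.exp (δ * torusSupNorm (Mk ⟨d + 1, L, m, K, hd, hL⟩ j)
            (rep (Mk ⟨d + 1, L, m, K, hd, hL⟩ j) b.src - rep (Mk ⟨d + 1, L, m, K, hd, hL⟩ j) b'.src)) - 1) *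
          |⟪EuclideanSpace.single b (1 : ℝ), (tsV1 hc Λ' w).Δj (EuclideanSpace.single b' (1 : ℝ))⟫_ℝ| ≤
      δ * (c ^ 2 / (eta L j ^ (d + 1) * ((L : ℝ) ^ j) ^ 2) * (MC (d + 1) (kappa166 (d + 1)) * periodConst (kappa166 (d + 1)) d) *
          (4 / (kappa166 (d + 1) / ((d : ℝ) + 1)))) *
        (((d : ℝ) + 1) * latticeConst (d + 1) (kappa166 (d + 1) / ((d : ℝ) + 1) / 4)) := by
  set M := Mk (⟨d + 1, L, m, K, hd, hL⟩ : Params) j with hM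
  set κ₁ := kappa166 (d + 1) / ((d : ℝ) + 1) with hκ₁
  set Θ := c ^ 2 / (eta L j ^ (d + 1) * ((L : ℝ) ^ j) ^ 2) * (MC (d + 1) (kappa166 (d + 1)) * periodConst (kappa166 (d + 1)) d) with hΘ
  have hκ : 0 < κ₁ := div_pos (kappa166_pos _) (by positivity)
  have hpt : ∀ b' : PBond (⟨d + 1, L, m, K, hd, hL⟩ : Params) j, (Real.exp (δ * torusSupNorm M (rep M b.src - rep M b'.src)) - 1) *
      |⟪EuclideanSpace.single b (1 : ℝ), (tsV1 hc Λ' w).Δj (EuclideanSpace.single b' (1 : ℝ))⟫_ℝ| ≤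
        δ * (Θ * (4 / κ₁)) * Real.exp (-(κ₁ / 4 * torusSupNorm M (rep M b.src - rep M b'.src))) := fun b' => by
    refine pointwise_le₀ hκ hδ0 hδ (torusSupNorm_nonneg (one_le_M M) _) (abs_nonneg _) ?_
    have h := kernel_Δj_decay hc Λ' hw hj b b'
    simpa only [hΘ, hκ₁, mul_assoc] using h
  have hΘ0 : 0 ≤ Θ := by
    have h := kernel_Δj_decay hc Λ' hw hj b b
    rw [sub_self, torusSupNorm_zero, mul_zero, neg_zero, Real.exp_zero, mul_one] at h
    exact (abs_nonneg _).trans (by simpa only [hΘ, mul_assoc] using h)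
  calc ∑ b' : PBond (⟨d + 1, L, m, K, hd, hL⟩ : Params) j, (Real.exp (δ * torusSupNorm M (rep M b.src - rep M b'.src)) - 1) *
          |⟪EuclideanSpace.single b (1 : ℝ), (tsV1 hc Λ' w).Δj (EuclideanSpace.single b' (1 : ℝ))⟫_ℝ|
      ≤ ∑ b' : PBond (⟨d + 1, L, m, K, hd, hL⟩ : Params) j, δ * (Θ * (4 / κ₁)) * Real.exp (-(κ₁ / 4 * torusSupNorm M (rep M b.src - rep M b'.src))) :=
        Finset.sum_le_sum fun b' _ => hpt b'
    _ = δ * (Θ * (4 / κ₁)) * ∑ b' : PBond (⟨d + 1, L, m, K, hd, hL⟩ : Params) j, Real.exp (-(κ₁ / 4 * torusSupNorm M (rep M b.src - rep M b'.src))) := by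
        rw [Finset.mul_sum]
    _ = δ * (Θ * (4 / κ₁)) * (((d : ℝ) + 1) * ∑ x' : Site (⟨d + 1, L, m, K, hd, hL⟩ : Params) j, Real.exp (-(κ₁ / 4 * torusSupNorm M (rep M b.src - rep M x')))) := by
        congr 1
        rw [sum_bond_eq]
        simp only [Finset.sum_const, Finset.card_univ, Fintype.card_fin, nsmul_eq_mul]
        rw [Finset.mul_sum]
        push_cast
        rfl
    _ ≤ δ * (Θ * (4 / κ₁)) * (((d : ℝ) + 1) * latticeConst (d + 1) (κ₁ / 4)) := by
        refine mul_le_mul_of_nonneg_left (mul_le_mul_of_nonneg_left ?_ (by positivity)) (by positivity)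
        exact sum_exp_torusSupNorm_sub_rep_le M (div_pos hκ (by norm_num)) (rep M b.src)

end RowSums

end Literature.MathematicalPhysics.QuantumFieldTheory.Balaban1983to89.B6CovTildeRowSumV1

end
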